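import Summits.Ventures.YMGap.RobustBall.HeatBathPoincare
import Summits.Ventures.YMGap.Thresholds.LatticeBakryEmeryLipschitz
import Summits.Ventures.YMGap.Thresholds.LatticeBakryEmeryBochner
import Literature.MathematicalPhysics.QuantumFieldTheory.SUNBakryEmeryPoincare
import HarnessLib

/-!
# Robust ball (Y2) — THE LANGEVIN (GRADIENT-FORM) POINCARÉ INEQUALITY OF STRONG-COUPLING `SU(N)` LATTICE YANG–MILLS,
# UNIFORMLY IN THE VOLUME, ON THE KANTOROVICH–RUBINSTEIN WINDOW (`SU(2)`, `d = 4`: `β_W < 2/9`)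

HONEST FRAMING: venture file of the cell `pub-ymgap` (QuantumFields programme), track ROBUST-BALL, seat rb-p2 (g13).  LATTICE statements at STRONG
COUPLING for the torus Wilson measures `μ_{β,L}` of `SU(N)` on `(ℤ/L)⁴`, `L ≥ 2`, with constants independent of `L`; Wilson action only (class K);
nothing about `β → ∞`, the continuum or Clay.

THE STATEMENT (`variance_le_integral_Gam_of_oneLinkKRModulus`): `d = 4`, tree coupling `β`, `(|β|/N)·6 ≤ R`, `OneLinkKRModulus N R K`,
`c := 18 (|β|/N) K < 1`, `K₀ := N/2 − 6|β| > 0`.  Then for EVERY torus side `L ≥ 2` and every smooth function `f` of the link matrices,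
`Var_{μ_{β,L}}(f) ≤ ((1 − c)·K₀)⁻¹ ∫ Γ(f,f) dμ_{β,L}`, where `Γ(f,f) = ∑_e |∇_e f|²` is the carré du champ of the product Hilbert–Schmidt metric on
`SU(N)^E` (the venture's `LatticeBakryEmery.Gam`, Shen–Zhu–Zhu's (3.7)) — VERBATIM the currency of the venture's Bakry–Émery theorem
`LatticeBakryEmery.torus_variance_le_integral_Gam` (`SharpPoincare.lean`: constant `(N/2 − 4dN|b|)⁻¹` on 't Hooft `|b| < 1/32`) and of Shen–Zhu–Zhu's
Cor. 4.4 (4.11) (CMP 400 (2023): `K_S = N/2 − 8(d−1)N|b|`, `|b| < 1/48`): the Langevin dynamics (SZZ (1.6)) has a spectral gap `≥ (1 − c)K₀`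
uniformly in the volume.  ★★★ `su2_variance_le_integral_Gam` — `SU(2)`, HYPOTHESIS-FREE on `0 ≤ β_W < 2/9` (quarter modulus): constant
`((1 − 9β_W/2)(1 − 3β_W))⁻¹`.  The two Bakry–Émery windows for this inequality are `β_W < 1/12` (SZZ, printed) and `β_W < 1/8` (venture, constant
`(1 − 8β_W)⁻¹`); the present window `β_W < 2/9` is `16/9` times the latter, and the constant is smaller already for `β_W ≥ 0.07` (at `β_W = 1/12`:
`32/15` vs `3`; at `β_W → 1/8`: `128/35` vs `∞`).
MECHANISM (three kernel steps, no new definition): (1) the cell's HEAT-BATH Poincaré inequality `Var_μ(F) ≤ (2(1 − c))⁻¹ ∑_ℓ ∫∫ (F − F∘[ℓ ↦ g])² dν_ℓ dμ`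
(`HeatBathPoincare.heatBathPoincare_of_oneLinkKRModulus`, Dobrushin–Wu column sums); (2) DLR: the heat-bath Dirichlet form of a link is TWICE the mean
conditional variance (`dirichlet_eq_two_mul_condVariance`, from the YangMills summit's `StrongPinningPoincare.HeatBath.integral_heatBath`); (3) the
ONE-LINK Bakry–Émery Poincaré inequality of the tree (`SUNBakryEmery.poincare_pot`, `Ric = N/2`, one-link Hessian `≤ N‖B_U‖_op ≤ 6|β|`) applied to the
section `g ↦ f(U[ℓ ↦ g])`, whose one-link carré du champ is the link-`ℓ` block of `Γ(f,f)` (`gam_section`, chain rule through `Function.update`), and DLR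
once more to integrate the block back against `μ`.  0 sorry, 0 definitions.
References: H. Shen, R. Zhu, X. Zhu, CMP 400 (2023) 805–851, (1.6), (3.7), Cor. 4.4 (4.11); L. Wu, Ann. Probab. 34 (2006) 1960; D. Bakry, M. Émery,
LNM 1123 (1985).  Everything here is proved. [folklore]
-/

noncomputable section

open scoped Matrix ComplexConjugate BigOperators Matrix.Norms.Frobenius ContDiff Topology ProbabilityTheory
open Matrix Complex Finset MeasureTheory Filter ProbabilityTheory Function Real
open Literature.MathematicalPhysics.QuantumFieldTheory
open Literature.MathematicalPhysics.QuantumLattice (fundamentalRep continuous_fundamentalRep)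
open Literature.MathematicalPhysics.QuantumFieldTheory.SUNBakryEmery (SUN FrameIdx frame haarSU pot)
open Summit.Ventures.YMGap.LatticeBakryEmery
open Summit.QuantumFields.YangMills.Theorems.StrongPinningPoincare

namespace Summit.Ventures.YMGap.RobustBall.LangevinPoincare

universe u

/-! ### The one-link section of a smooth function of the link matrices -/

section Section

variable {ι : Type u} [Fintype ι] [DecidableEq ι] {N : ℕ}

omit [Fintype ι] in
/-- The derivative of `update c i` is the block inclusion `P ↦ single_i P`. [folklore] -/
theorem piSingle_apply (i : ι) (P : Matrix (Fin N) (Fin N) ℂ) :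
    (ContinuousLinearMap.pi (Pi.single i (ContinuousLinearMap.id ℝ (Matrix (Fin N) (Fin N) ℂ))) :
      Matrix (Fin N) (Fin N) ℂ →L[ℝ] Cfg ι N) P = lk i P := by
  funext j; by_cases hj : j = i <;> [(subst hj; simp); simp [hj]]

/-- The section of a smooth function in one link is smooth. [folklore] -/
theorem contDiff_section {f : Cfg ι N → ℝ} (hf : ContDiff ℝ ∞ f) (c : Cfg ι N) (i : ι) :
    ContDiff ℝ ∞ fun P : Matrix (Fin N) (Fin N) ℂ => f (update c i P) := by
  have h1 : (update c i : Matrix (Fin N) (Fin N) ℂ → Cfg ι N) =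
      fun P => update c i 0 + (ContinuousLinearMap.pi (Pi.single i (ContinuousLinearMap.id ℝ (Matrix (Fin N) (Fin N) ℂ)))) P := by
    funext P; rw [piSingle_apply]; funext j; by_cases hj : j = i <;> [(subst hj; simp); simp [hj]]
  exact hf.comp (by rw [h1]; exact contDiff_const.add (ContinuousLinearMap.contDiff _))

/-- **One-link derivatives of the section are the link derivatives of the function**:
`D_Y (f ∘ update c i)(Q) = D_{single_i Y} f (update c i Q)` (chain rule through `update`). [folklore] -/
theorem matD_section {f : Cfg ι N → ℝ} (hf : ContDiff ℝ ∞ f) (c : Cfg ι N) (i : ι) (Y Q : Matrix (Fin N) (Fin N) ℂ) :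
    SUNBakryEmery.matD Y (fun P => f (update c i P)) Q = algD (lk i Y) f (update c i Q) := by
  have key : HasFDerivAt (fun P => f (update c i P)) ((fderiv ℝ f (update c i Q)).comp
      (ContinuousLinearMap.pi (Pi.single i (ContinuousLinearMap.id ℝ (Matrix (Fin N) (Fin N) ℂ))))) Q :=
    (hf.differentiable (by simp) _).hasFDerivAt.comp Q (hasFDerivAt_update (𝕜 := ℝ) c (i := i) Q)
  have e1 : SUNBakryEmery.matD Y (fun P => f (update c i P)) Q = ((fderiv ℝ f (update c i Q)).comp
      (ContinuousLinearMap.pi (Pi.single i (ContinuousLinearMap.id ℝ (Matrix (Fin N) (Fin N) ℂ))))) (Q * Y) := by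
    have h := congrArg (fun T : Matrix (Fin N) (Fin N) ℂ →L[ℝ] ℝ => T (Q * Y)) key.fderiv
    exact h
  rw [e1, ContinuousLinearMap.comp_apply, piSingle_apply, ← update_self i Q c, ← mul_lk, update_self]
  rfl

/-- **The one-link carré du champ of the section is the link-`i` block of `Γ`**:
`Γ₁(f ∘ update c i)(Q) = ∑_α (D_{single_i Y_α} f (update c i Q))²`. [folklore] -/
theorem gam_section {f : Cfg ι N → ℝ} (hf : ContDiff ℝ ∞ f) (c : Cfg ι N) (i : ι) (Q : Matrix (Fin N) (Fin N) ℂ) :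
    SUNBakryEmery.Gam (fun P => f (update c i P)) (fun P => f (update c i P)) Q =
      ∑ α : FrameIdx N, algD (lk i (frame α)) f (update c i Q) ^ 2 := by
  unfold SUNBakryEmery.Gam
  exact Finset.sum_congr rfl fun α _ => by rw [matD_section hf c i, sq]

/-- `Γ(f,f)` is the sum of its link blocks. [folklore] -/
theorem Gam_eq_sum_blocks (f : Cfg ι N → ℝ) (Q : Cfg ι N) :
    Gam f f Q = ∑ i : ι, ∑ α : FrameIdx N, algD (lk i (frame α)) f Q ^ 2 := by
  rw [Gam_self_eq_sum_linkFun]; simp only [linkFun_apply]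

omit [Fintype ι] in
/-- `emb (update x i g) = update (emb x) i ↑g`. [folklore] -/
theorem emb_update (x : PSU ι N) (i : ι) (g : SUN N) : emb (update x i g) = update (emb x) i (g : Matrix (Fin N) (Fin N) ℂ) := by
  funext j; by_cases hj : j = i <;> [(subst hj; simp [emb]); simp [emb, hj]]

/-- **One-link Bakry–Émery Poincaré inequality for a section** (Shen–Zhu–Zhu Cor. 4.4 (4.11) on one link = the tree's
`SUNBakryEmery.poincare_pot`, normalised): for the tilted one-link law `ν_B = Haar.tilted(N Re tr(· B))` with `K₁ = N/2 − N‖B‖_op > 0` and smooth `f`,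
`K₁ · Var_{ν_B}(g ↦ f(c[i ↦ g])) ≤ ∫ ∑_α (D_{single_i Y_α} f (c[i ↦ g]))² dν_B(g)`. [folklore] -/
theorem section_variance_le (hN : N ≠ 0) {f : Cfg ι N → ℝ} (hf : ContDiff ℝ ∞ f) (c : Cfg ι N) (i : ι)
    (B : Matrix (Fin N) (Fin N) ℂ) (hK : 0 < (N : ℝ) / 2 - N * matrixOpNorm B) :
    ((N : ℝ) / 2 - N * matrixOpNorm B) *
        Var[fun g : SUN N => f (update c i (g : Matrix (Fin N) (Fin N) ℂ));
          (haarSU N).tilted fun g : SUN N => (N : ℝ) * ((g : Matrix (Fin N) (Fin N) ℂ) * B).trace.re] ≤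
      ∫ g : SUN N, ∑ α : FrameIdx N, algD (lk i (frame α)) f (update c i (g : Matrix (Fin N) (Fin N) ℂ)) ^ 2
        ∂((haarSU N).tilted fun g : SUN N => (N : ℝ) * ((g : Matrix (Fin N) (Fin N) ℂ) * B).trace.re) := by
  set u : Matrix (Fin N) (Fin N) ℂ → ℝ := fun P => f (update c i P) with hu_def
  have hu : ContDiff ℝ ∞ u := contDiff_section hf c i
  have hK' : 0 < (N : ℝ) / 2 - |(N : ℝ)| * matrixOpNorm B := by rwa [Nat.abs_cast]
  have hP := SUNBakryEmery.poincare_pot hN (N : ℝ) B hK' hu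
  rw [Nat.abs_cast] at hP
  rw [show (fun g : SUN N => (N : ℝ) * ((g : Matrix (Fin N) (Fin N) ℂ) * B).trace.re) = fun g : SUN N => pot (N : ℝ) B g from rfl]
  set ν : Measure (SUN N) := (haarSU N).tilted fun g : SUN N => pot (N : ℝ) B g with hν
  have hwc : Continuous fun g : SUN N => Real.exp (pot (N : ℝ) B g) :=
    Real.continuous_exp.comp (SUNBakryEmery.continuous_restrict (SUNBakryEmery.contDiff_pot _ B))
  set Z : ℝ := ∫ g, Real.exp (pot (N : ℝ) B g) ∂(haarSU N) with hZ
  have hZpos : 0 < Z := integral_exp_pos (SUNBakryEmery.integrable_of_continuous_SUN hwc _)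
  haveI : IsProbabilityMeasure ν := isProbabilityMeasure_tilted (SUNBakryEmery.integrable_of_continuous_SUN hwc _)
  have hψc : Continuous fun g : SUN N => u (g : Matrix (Fin N) (Fin N) ℂ) := SUNBakryEmery.continuous_restrict hu
  set m : ℝ := (∫ g : SUN N, Real.exp (pot (N : ℝ) B g) * u g ∂(haarSU N)) / Z with hm
  have hmean : ∫ g, u (g : Matrix (Fin N) (Fin N) ℂ) ∂ν = m := SUNBakryEmery.integral_tilted_eq_div _ _
  have hvar : Var[fun g : SUN N => u (g : Matrix (Fin N) (Fin N) ℂ); ν] =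
      (∫ g : SUN N, Real.exp (pot (N : ℝ) B g) * (u g - m) ^ 2 ∂(haarSU N)) / Z := by
    rw [variance_eq_integral hψc.measurable.aemeasurable]
    simp only [hmean]
    exact SUNBakryEmery.integral_tilted_eq_div _ _
  have hG : ∫ g : SUN N, ∑ α : FrameIdx N, algD (lk i (frame α)) f (update c i (g : Matrix (Fin N) (Fin N) ℂ)) ^ 2 ∂ν =
      (∫ g : SUN N, Real.exp (pot (N : ℝ) B g) * SUNBakryEmery.Gam u u g ∂(haarSU N)) / Z := by
    rw [SUNBakryEmery.integral_tilted_eq_div]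
    congr 1
    refine integral_congr_ae (ae_of_all _ fun g => ?_)
    simp only [hu_def]
    rw [gam_section hf c i]
  show ((N : ℝ) / 2 - N * matrixOpNorm B) * Var[fun g : SUN N => u (g : Matrix (Fin N) (Fin N) ℂ); ν] ≤ _
  rw [hvar, hG, ← mul_div_assoc]
  exact div_le_div_of_nonneg_right hP hZpos.le

end Section

/-! ### The heat-bath Dirichlet form is twice the mean conditional variance (DLR) -/

section Fibre

variable {ι : Type*} [Fintype ι] [DecidableEq ι] {E : Type*} [MeasurableSpace E]
  (lam : Measure E) [IsProbabilityMeasure lam] {V : (ι → E) → ℝ}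

omit [Fintype ι] in
/-- **Fibre identity**: for the one-site heat bath `ν_x = lam.tilted (V ∘ update x i)` (a probability measure) and bounded measurable `F`,
`∫ (F(x) − F(x[i ↦ e]))² dν_x(e) = (F(x) − P_iF(x))² + ∫ (F(x[i ↦ e]) − P_iF(x))² dν_x(e)`, `P_iF(x) = ∫ F(x[i ↦ e]) dν_x(e)`. [folklore] -/
theorem fibre_sq_eq (hV : Measurable V) {Bv : ℝ} (hB : ∀ x, |V x| ≤ Bv) (i : ι) {F : (ι → E) → ℝ} (hF : Measurable F)
    {M : ℝ} (hM : ∀ x, |F x| ≤ M) (x : ι → E) :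
    ∫ e, (F x - F (update x i e)) ^ 2 ∂(lam.tilted fun e => V (update x i e)) =
      (F x - ∫ e', F (update x i e') ∂(lam.tilted fun e' => V (update x i e'))) ^ 2 +
        ∫ e, (F (update x i e) - ∫ e', F (update x i e') ∂(lam.tilted fun e' => V (update x i e'))) ^ 2
          ∂(lam.tilted fun e => V (update x i e)) := by
  haveI := HeatBath.isProbabilityMeasure_heatBath lam hV hB x i
  set ν : Measure E := lam.tilted fun e => V (update x i e) with hν
  have hPb : |∫ e', F (update x i e') ∂ν| ≤ M := HeatBath.abs_heatBath_le lam hV hB x i hM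
  set P : ℝ := ∫ e', F (update x i e') ∂ν with hP
  have hψm : Measurable fun e => F (update x i e) := hF.comp (measurable_update x)
  have hψi : Integrable (fun e => F (update x i e)) ν := HeatBath.integrable_of_abs_le hψm (fun e => hM _)
  have hψ2i : Integrable (fun e => (F (update x i e) - P) ^ 2) ν := by
    refine HeatBath.integrable_of_abs_le ((hψm.sub measurable_const).pow_const 2) (C := (2 * M) ^ 2) fun e => ?_
    rw [abs_pow]
    refine pow_le_pow_left₀ (abs_nonneg _) ?_ 2
    calc |F (update x i e) - P| ≤ |F (update x i e)| + |P| := abs_sub _ _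
      _ ≤ M + M := add_le_add (hM _) hPb
      _ = 2 * M := by ring
  have hlin : Integrable (fun e => 2 * (F x - P) * (P - F (update x i e))) ν :=
    ((integrable_const P).sub hψi).const_mul (2 * (F x - P))
  have hI3 : Integrable (fun e => (F x - P) ^ 2 + 2 * (F x - P) * (P - F (update x i e))) ν :=
    (integrable_const _).add hlin
  have e1 : (fun e => (F x - F (update x i e)) ^ 2) =
      fun e => ((F x - P) ^ 2 + 2 * (F x - P) * (P - F (update x i e))) + (F (update x i e) - P) ^ 2 := by
    funext e; ring
  rw [e1, integral_add (f := fun e => (F x - P) ^ 2 + 2 * (F x - P) * (P - F (update x i e)))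
      (g := fun e => (F (update x i e) - P) ^ 2) hI3 hψ2i,
    integral_add (f := fun _ => (F x - P) ^ 2) (g := fun e => 2 * (F x - P) * (P - F (update x i e))) (integrable_const _) hlin,
    integral_const_mul, integral_sub (f := fun _ => P) (g := fun e => F (update x i e)) (integrable_const P) hψi]
  simp only [integral_const, probReal_univ, smul_eq_mul, one_mul]
  rw [← hP]
  ring

/-- For bounded measurable `f`, the heat-bath average `x ↦ ∫ f(x[i ↦ e]) dν_x(e)` is integrable for the Gibbs measure. [folklore] -/
theorem integrable_heatBath (hV : Measurable V) {Bv : ℝ} (hB : ∀ x, |V x| ≤ Bv) (i : ι) {f : (ι → E) → ℝ} (hf : Measurable f)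
    {Mf : ℝ} (hMf : ∀ x, |f x| ≤ Mf) :
    Integrable (fun x => ∫ e, f (update x i e) ∂(lam.tilted fun e => V (update x i e))) ((Measure.pi fun _ : ι => lam).tilted V) :=
  haveI := HeatBath.isProbabilityMeasure_gibbs lam hV hB
  HeatBath.integrable_of_abs_le (HeatBath.measurable_heatBath lam hV i hf) fun x => HeatBath.abs_heatBath_le lam hV hB x i hMf

/-- **The heat-bath Dirichlet form of a link is twice the mean conditional variance** (DLR invariance of the Gibbs measure
`μ = (lam^{⊗ι}).tilted V` under heat-bath resampling): for bounded measurable `F`,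
`∫∫ (F(x) − F(x[i ↦ e]))² dν_x dμ = 2 ∫∫ (F(x[i ↦ e]) − P_iF(x))² dν_x dμ`. [folklore] -/
theorem dirichlet_eq_two_mul_condVariance (hV : Measurable V) {Bv : ℝ} (hB : ∀ x, |V x| ≤ Bv) (i : ι)
    {F : (ι → E) → ℝ} (hF : Measurable F) {M : ℝ} (hM : ∀ x, |F x| ≤ M) :
    ∫ x, ∫ e, (F x - F (update x i e)) ^ 2 ∂(lam.tilted fun e => V (update x i e)) ∂((Measure.pi fun _ : ι => lam).tilted V) =
      2 * ∫ x, ∫ e, (F (update x i e) - ∫ e', F (update x i e') ∂(lam.tilted fun e' => V (update x i e'))) ^ 2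
        ∂(lam.tilted fun e => V (update x i e)) ∂((Measure.pi fun _ : ι => lam).tilted V) := by
  haveI := HeatBath.isProbabilityMeasure_gibbs lam hV hB
  set P : (ι → E) → ℝ := fun x => ∫ e', F (update x i e') ∂(lam.tilted fun e' => V (update x i e')) with hP
  have hPm : Measurable P := HeatBath.measurable_heatBath lam hV i hF
  have hPb : ∀ x, |P x| ≤ M := fun x => HeatBath.abs_heatBath_le lam hV hB x i hM
  have hPupd : ∀ x e, P (update x i e) = P x := fun x e => by simp only [hP, update_idem]
  -- the square deviation `h = (F − P_iF)²` is bounded measurable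
  have hh : Measurable fun y => (F y - P y) ^ 2 := (hF.sub hPm).pow_const 2
  have hhb : ∀ y, |(F y - P y) ^ 2| ≤ (2 * M) ^ 2 := fun y => by
    rw [abs_pow]
    refine pow_le_pow_left₀ (abs_nonneg _) ?_ 2
    calc |F y - P y| ≤ |F y| + |P y| := abs_sub _ _
      _ ≤ M + M := add_le_add (hM y) (hPb y)
      _ = 2 * M := by ring
  have hfib : ∀ x, ∫ e, (F x - F (update x i e)) ^ 2 ∂(lam.tilted fun e => V (update x i e)) =
      (F x - P x) ^ 2 + ∫ e, (F (update x i e) - P x) ^ 2 ∂(lam.tilted fun e => V (update x i e)) :=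
    fun x => fibre_sq_eq lam hV hB i hF hM x
  simp_rw [hfib]
  -- DLR: `∫ (F − P_iF)² dμ = ∫∫ (F(x[i ↦ e]) − P_iF(x))² dν_x dμ`
  have hDLR := HeatBath.integral_heatBath lam hV hB i hh hhb
  have hI2 := integrable_heatBath lam hV hB i hh hhb
  simp only [hPupd] at hDLR hI2
  rw [integral_add (HeatBath.integrable_of_abs_le hh hhb) hI2, ← hDLR]
  ring

end Fibre

/-! ### The torus: conditional variances of the Wilson measure and the Langevin Poincaré inequality -/

section Main

open Literature.MathematicalPhysics.QuantumFieldTheory.Balaban1983to89.StrongCouplingTorusWindow (tField matrixOpNorm_tField_le)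
open Literature.MathematicalPhysics.QuantumFieldTheory.Balaban1983to89.StrongCouplingDobrushinWindow (OneLinkKRModulus)
open Summit.Ventures.YMGap.RobustBall.HeatBathPoincare (heatBathPoincare_of_oneLinkKRModulus heatBath_eq_tilted_tField)

variable {N L : ℕ} [NeZero L]

/-- **The conditional variance of a smooth observable in one link is controlled by the link block of `Γ`** (one-link Bakry–Émery on the
heat bath `ν_ℓ^U = Haar.tilted(−β S_W(U[ℓ ↦ ·])) = ν_{B_U}`, `‖B_U‖_op ≤ 6|β|/N`): for `K₀ = N/2 − 6|β| > 0`, torus side `≥ 2`,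
`Var_{ν_ℓ^U}(g ↦ f(U[ℓ ↦ g])) ≤ K₀⁻¹ ∫ ∑_α (D_{single_ℓ Y_α} f (U[ℓ ↦ g]))² dν_ℓ^U(g)`. [folklore] -/
theorem condVariance_le (hN : 1 ≤ N) (β : ℝ) (hK₀ : 0 < (N : ℝ) / 2 - 6 * |β|) (hL : 1 < L)
    {f : Cfg (Edge 4 L) N → ℝ} (hf : ContDiff ℝ ∞ f) (ℓ : Edge 4 L) (U : GaugeConfig 4 L (SUN N)) :
    ∫ g, (f (emb (update U ℓ g)) - ∫ g', f (emb (update U ℓ g'))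
        ∂((haarProbability (SUN N)).tilted fun g'' => -β * wilsonAction (fundamentalRep (Fin N)) (update U ℓ g''))) ^ 2
        ∂((haarProbability (SUN N)).tilted fun g'' => -β * wilsonAction (fundamentalRep (Fin N)) (update U ℓ g'')) ≤
      ((N : ℝ) / 2 - 6 * |β|)⁻¹ *
        ∫ g, ∑ α : FrameIdx N, algD (lk ℓ (frame α)) f (emb (update U ℓ g)) ^ 2
          ∂((haarProbability (SUN N)).tilted fun g'' => -β * wilsonAction (fundamentalRep (Fin N)) (update U ℓ g'')) := by
  have hNpos : (0 : ℝ) < N := by exact_mod_cast (show 0 < N by omega)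
  rw [heatBath_eq_tilted_tField hL hN β ℓ U]
  set B := tField β ℓ U with hBdef
  -- the one-link Bakry–Émery constant at this boundary condition dominates `K₀`
  have hB : matrixOpNorm B ≤ |β| / N * 6 := by
    have h := matrixOpNorm_tField_le (d := 4) (L := L) (by norm_num) hN β ℓ U
    norm_num at h
    linarith
  have hK1 : (N : ℝ) / 2 - 6 * |β| ≤ (N : ℝ) / 2 - N * matrixOpNorm B := by
    have : (N : ℝ) * matrixOpNorm B ≤ N * (|β| / N * 6) := mul_le_mul_of_nonneg_left hB hNpos.le
    have e : (N : ℝ) * (|β| / N * 6) = 6 * |β| := by field_simp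
    linarith
  have hsec := section_variance_le (by omega) hf (emb U) ℓ B (lt_of_lt_of_le hK₀ hK1)
  simp_rw [emb_update]
  set ν : Measure (SUN N) := (haarSU N).tilted fun g : SUN N => (N : ℝ) * ((g : Matrix (Fin N) (Fin N) ℂ) * B).trace.re with hν
  have hwc : Continuous fun g : SUN N => Real.exp (pot (N : ℝ) B g) :=
    Real.continuous_exp.comp (SUNBakryEmery.continuous_restrict (SUNBakryEmery.contDiff_pot _ B))
  haveI : IsProbabilityMeasure ν := isProbabilityMeasure_tilted (SUNBakryEmery.integrable_of_continuous_SUN hwc _)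
  have hψc : Continuous fun g : SUN N => f (update (emb U) ℓ (g : Matrix (Fin N) (Fin N) ℂ)) :=
    SUNBakryEmery.continuous_restrict (contDiff_section hf (emb U) ℓ)
  have hvar : Var[fun g : SUN N => f (update (emb U) ℓ (g : Matrix (Fin N) (Fin N) ℂ)); ν] = ∫ g, (f (update (emb U) ℓ
      (g : Matrix (Fin N) (Fin N) ℂ)) - ∫ g', f (update (emb U) ℓ (g' : Matrix (Fin N) (Fin N) ℂ)) ∂ν) ^ 2 ∂ν :=
    variance_eq_integral hψc.measurable.aemeasurable
  show ∫ g, (f (update (emb U) ℓ (g : Matrix (Fin N) (Fin N) ℂ)) - ∫ g', f (update (emb U) ℓ (g' : Matrix (Fin N) (Fin N) ℂ)) ∂ν) ^ 2 ∂ν ≤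
    ((N : ℝ) / 2 - 6 * |β|)⁻¹ * ∫ g, ∑ α : FrameIdx N, algD (lk ℓ (frame α)) f (update (emb U) ℓ (g : Matrix (Fin N) (Fin N) ℂ)) ^ 2 ∂ν
  rw [← hvar, ← div_eq_inv_mul, le_div_iff₀ hK₀]
  calc Var[fun g : SUN N => f (update (emb U) ℓ (g : Matrix (Fin N) (Fin N) ℂ)); ν] * ((N : ℝ) / 2 - 6 * |β|)
      ≤ Var[fun g : SUN N => f (update (emb U) ℓ (g : Matrix (Fin N) (Fin N) ℂ)); ν] * ((N : ℝ) / 2 - N * matrixOpNorm B) :=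
        mul_le_mul_of_nonneg_left hK1 (variance_nonneg _ _)
    _ ≤ _ := by rw [mul_comm]; exact hsec

/-- ★★★ **THE LANGEVIN (GRADIENT-FORM) POINCARÉ INEQUALITY OF STRONG-COUPLING `SU(N)` LATTICE YANG–MILLS, UNIFORMLY IN THE VOLUME, ON THE
KANTOROVICH–RUBINSTEIN WINDOW** (`d = 4`, tree coupling `β`, every torus side `L ≥ 2`): if `(|β|/N)·6 ≤ R`, `OneLinkKRModulus N R K`,
`18 (|β|/N) K ≤ c < 1` and `K₀ := N/2 − 6|β| > 0`, then for every smooth function `f` of the link matrices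
`Var_{μ_{β,L}}(f) ≤ ((1 − c) K₀)⁻¹ ∫ Γ(f,f) dμ_{β,L}`, `Γ(f,f) = ∑_e |∇_e f|²` the carré du champ of the product Hilbert–Schmidt metric on `SU(N)^E`
(Shen–Zhu–Zhu's (3.7)/(4.11) currency, the venture's `LatticeBakryEmery.Gam`) — the Langevin dynamics has a spectral gap `≥ (1 − c) K₀` on every torus.
MECHANISM: heat-bath Poincaré (Dobrushin–Wu, column sums `≤ c`) ∘ (Dirichlet form = twice the mean conditional variance, DLR) ∘ one-link Bakry–Émery
(`Ric = N/2`, one-link Hessian `≤ N‖B_U‖_op ≤ 6|β|`). [folklore] -/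
theorem variance_le_integral_Gam_of_oneLinkKRModulus (hN : 1 ≤ N) {β R K c : ℝ} (hK : 0 ≤ K) (hR : |β| / N * 6 ≤ R)
    (hmod : OneLinkKRModulus N R K) (hc : 18 * (|β| / N) * K ≤ c) (hc1 : c < 1) (hK₀ : 0 < (N : ℝ) / 2 - 6 * |β|)
    (hL : 1 < L) {f : Cfg (Edge 4 L) N → ℝ} (hf : ContDiff ℝ ∞ f) :
    Var[fun U => f (emb U); wilsonMeasure (d := 4) (L := L) (fundamentalRep (Fin N)) β] ≤
      ((1 - c) * ((N : ℝ) / 2 - 6 * |β|))⁻¹ *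
        ∫ U, Gam f f (emb U) ∂(wilsonMeasure (d := 4) (L := L) (fundamentalRep (Fin N)) β) := by
  classical
  haveI : SecondCountableTopology (Matrix (Fin N) (Fin N) ℂ) :=
    inferInstanceAs (SecondCountableTopology (Fin N → Fin N → ℂ))
  haveI : SecondCountableTopology (SUN N) := Topology.IsEmbedding.subtypeVal.secondCountableTopology
  have hρc := continuous_fundamentalRep (Fin N)
  set μ : Measure (GaugeConfig 4 L (SUN N)) := wilsonMeasure (d := 4) (L := L) (fundamentalRep (Fin N)) β with hμdef
  haveI : IsProbabilityMeasure μ := isProbabilityMeasure_wilsonMeasure (d := 4) (L := L) (fundamentalRep (Fin N)) hρc β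
  have hc0 : 0 < 1 - c := by linarith
  have hbdd : ∀ {φ : GaugeConfig 4 L (SUN N) → ℝ}, Continuous φ → ∃ M : ℝ, ∀ U, |φ U| ≤ M := fun hφ => by
    obtain ⟨C, hC⟩ := (isCompact_univ (X := GaugeConfig 4 L (SUN N))).exists_bound_of_continuousOn hφ.continuousOn
    exact ⟨C, fun U => by simpa [Real.norm_eq_abs] using hC U (Set.mem_univ _)⟩
  -- the observable `F = f ∘ emb`: continuous, hence bounded and measurable
  set F : GaugeConfig 4 L (SUN N) → ℝ := fun U => f (emb U) with hFdef
  have hFc : Continuous F := hf.continuous.comp continuous_emb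
  have hFm : Measurable F := hFc.measurable
  obtain ⟨M, hM⟩ := hbdd hFc
  -- (1) the heat-bath Poincaré inequality (rb-p2 g12)
  have hHB := heatBathPoincare_of_oneLinkKRModulus hN hK hR hmod hc hc1 hL F hFm ⟨M, hM⟩
  -- `μ` as a tilted product measure, with bounded measurable log-density `V = −β S_W`
  set V : GaugeConfig 4 L (SUN N) → ℝ := fun U => -β * wilsonAction (fundamentalRep (Fin N)) U with hV
  have hVm : Measurable V := (measurable_wilsonAction (fundamentalRep (Fin N)) hρc).const_mul _
  obtain ⟨B₁, hB₁⟩ := exists_abs_wilsonAction_le (d := 4) (L := L) (G := SUN N) (fundamentalRep (Fin N)) hρc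
  have hVb : ∀ U, |V U| ≤ |β| * B₁ := fun U => by
    simp only [hV, abs_mul, abs_neg]
    exact mul_le_mul_of_nonneg_left (hB₁ U) (abs_nonneg _)
  have hμ : μ = (Measure.pi fun _ : Edge 4 L => haarProbability (SUN N)).tilted V :=
    Literature.MathematicalPhysics.QuantumLattice.wilsonMeasure_eq_tilted_pi (fundamentalRep (Fin N)) hρc β
  -- the link blocks of `Γ(f,f)` as observables
  have hblkc : ∀ ℓ : Edge 4 L, Continuous fun U : GaugeConfig 4 L (SUN N) => ∑ α : FrameIdx N, algD (lk ℓ (frame α)) f (emb U) ^ 2 :=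
    fun ℓ => continuous_finsetSum _ fun α _ => ((contDiff_algD hf _).continuous.comp continuous_emb).pow 2
  -- (2)+(3) PER LINK: Dirichlet form = 2 × mean conditional variance ≤ (2/K₀) ∫∫ block dν dμ = (2/K₀) ∫ block dμ (DLR)
  have key : ∀ ℓ : Edge 4 L,
      ∫ U, ∫ g, (F U - F (update U ℓ g)) ^ 2 ∂((haarProbability (SUN N)).tilted fun g' => V (update U ℓ g')) ∂μ ≤
        2 * ((N : ℝ) / 2 - 6 * |β|)⁻¹ * ∫ U, ∑ α : FrameIdx N, algD (lk ℓ (frame α)) f (emb U) ^ 2 ∂μ := by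
    intro ℓ
    obtain ⟨Mb, hMb⟩ := hbdd (hblkc ℓ)
    rw [hμ, dirichlet_eq_two_mul_condVariance (haarProbability (SUN N)) hVm hVb ℓ hFm hM, ← hμ, mul_assoc]
    refine mul_le_mul_of_nonneg_left ?_ (by norm_num)
    have hDLR := HeatBath.integral_heatBath (haarProbability (SUN N)) hVm hVb ℓ (hblkc ℓ).measurable hMb
    rw [← hμ] at hDLR
    rw [← hDLR, ← integral_const_mul]
    -- integrability of both sides: heat-bath averages of bounded measurable functions
    set P : GaugeConfig 4 L (SUN N) → ℝ := fun y => ∫ g', F (update y ℓ g') ∂((haarProbability (SUN N)).tilted fun g'' => V (update y ℓ g''))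
      with hP
    have hPupd : ∀ y g, P (update y ℓ g) = P y := fun y g => by simp only [hP, update_idem]
    have hh : Measurable fun y => (F y - P y) ^ 2 := (hFm.sub (HeatBath.measurable_heatBath (haarProbability (SUN N)) hVm ℓ hFm)).pow_const 2
    have hhb : ∀ y, |(F y - P y) ^ 2| ≤ (2 * M) ^ 2 := fun y => by
      rw [abs_pow]
      refine pow_le_pow_left₀ (abs_nonneg _) ((abs_sub _ _).trans ?_) 2
      calc _ ≤ M + M := add_le_add (hM y) (HeatBath.abs_heatBath_le _ hVm hVb y ℓ hM)
        _ = 2 * M := by ring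
    have hI1 := integrable_heatBath (haarProbability (SUN N)) hVm hVb ℓ hh hhb
    simp only [hPupd] at hI1
    rw [← hμ] at hI1
    have hI2 := (integrable_heatBath (haarProbability (SUN N)) hVm hVb ℓ (hblkc ℓ).measurable hMb).const_mul
      ((N : ℝ) / 2 - 6 * |β|)⁻¹
    rw [← hμ] at hI2
    exact integral_mono hI1 hI2 fun U => condVariance_le hN β hK₀ hL hf ℓ U
  -- SUM OVER LINKS
  have hsum : ∑ ℓ : Edge 4 L, ∫ U, ∫ g, (F U - F (update U ℓ g)) ^ 2
        ∂((haarProbability (SUN N)).tilted fun g' => V (update U ℓ g')) ∂μ ≤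
      2 * ((N : ℝ) / 2 - 6 * |β|)⁻¹ * ∫ U, Gam f f (emb U) ∂μ := by
    calc _ ≤ ∑ ℓ : Edge 4 L, 2 * ((N : ℝ) / 2 - 6 * |β|)⁻¹ * ∫ U, ∑ α : FrameIdx N, algD (lk ℓ (frame α)) f (emb U) ^ 2 ∂μ :=
          Finset.sum_le_sum fun ℓ _ => key ℓ
      _ = 2 * ((N : ℝ) / 2 - 6 * |β|)⁻¹ * ∫ U, Gam f f (emb U) ∂μ := by
          rw [← Finset.mul_sum, ← integral_finsetSum _ fun ℓ _ => integrable_of_continuous_PSU (hblkc ℓ) μ]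
          congr 1
          refine integral_congr_ae (ae_of_all _ fun U => ?_)
          simp only [Gam_eq_sum_blocks]
  -- ASSEMBLY
  calc Var[F; μ] ≤ (2 * (1 - c))⁻¹ * ∑ ℓ : Edge 4 L, ∫ U, ∫ g, (F U - F (update U ℓ g)) ^ 2
        ∂((haarProbability (SUN N)).tilted fun g' => V (update U ℓ g')) ∂μ := hHB
    _ ≤ (2 * (1 - c))⁻¹ * (2 * ((N : ℝ) / 2 - 6 * |β|)⁻¹ * ∫ U, Gam f f (emb U) ∂μ) :=
        mul_le_mul_of_nonneg_left hsum (by positivity)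
    _ = ((1 - c) * ((N : ℝ) / 2 - 6 * |β|))⁻¹ * ∫ U, Gam f f (emb U) ∂μ := by
        field_simp

/-- ★★★ **`SU(2)`, `d = 4`, HYPOTHESIS-FREE: THE LANGEVIN POINCARÉ INEQUALITY UNIFORMLY IN THE VOLUME ON `0 ≤ β_W < 2/9`** (tree coupling `β_W/2`,
quarter modulus `OneLinkKRModulus 2 R 1`, `c = 9β_W/2`, `K₀ = 1 − 3β_W`): on every torus `(ℤ/L)⁴`, `L ≥ 2`, for every smooth `f` of the link matrices,
`Var_μ(f) ≤ ((1 − 9β_W/2)(1 − 3β_W))⁻¹ ∫ Γ(f,f) dμ` — spectral gap of the Langevin dynamics `≥ (1 − 9β_W/2)(1 − 3β_W)` uniformly in `L`.  The Bakry–Émery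
windows for the same inequality are `β_W < 1/12` (Shen–Zhu–Zhu, printed) and `β_W < 1/8` (venture `SharpPoincare`, constant `(1 − 8β_W)⁻¹`). [folklore] -/
theorem su2_variance_le_integral_Gam {βW : ℝ} (h0 : 0 ≤ βW) (h : βW < 2 / 9) (hL : 1 < L)
    {f : Cfg (Edge 4 L) 2 → ℝ} (hf : ContDiff ℝ ∞ f) :
    Var[fun U => f (emb U); wilsonMeasure (d := 4) (L := L) (fundamentalRep (Fin 2)) (βW / 2)] ≤
      ((1 - 9 * βW / 2) * (1 - 3 * βW))⁻¹ *
        ∫ U, Gam f f (emb U) ∂(wilsonMeasure (d := 4) (L := L) (fundamentalRep (Fin 2)) (βW / 2)) := by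
  have habs : |βW / 2| = βW / 2 := abs_of_nonneg (by positivity)
  have key := variance_le_integral_Gam_of_oneLinkKRModulus (N := 2) (L := L) (by norm_num) (β := βW / 2) zero_le_one
    (R := 3 * βW / 2) (by rw [habs]; push_cast; linarith) (SlabAreaLawDimensions.su2_oneLinkKRModulus_of_le_one (by linarith))
    (c := 9 * βW / 2) (by rw [habs]; push_cast; linarith) (by linarith) (by rw [habs]; push_cast; linarith) hL hf
  have e : ((2 : ℕ) : ℝ) / 2 - 6 * |βW / 2| = 1 - 3 * βW := by rw [habs]; push_cast; ring
  rw [e] at key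
  exact key

end Main

end Summit.Ventures.YMGap.RobustBall.LangevinPoincare

end
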